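import Literature.NumberTheory.GaloisRepresentations.SerreWeightShapeProofs
import Literature.NumberTheory.GaloisRepresentations.SerreWeightExistenceProofs
import HarnessLib

/-!
# Serre's recipe at a level-one shape `(ψ₁^β ∗; 0 ψ₁^α)` with `β > α + 1 ≥ 2`: the weight `1 + qα + β` (tame or wild alike),
# via the swap of the exponents in the tame case

Topic `NumberTheory/GaloisRepresentations`.  A *proofs* file (theorems only: no definition, no named fact, no `sorry`, no
instance, no notation).  Companion of `SerreWeightLevelOneEvaluationOfUniqueProofs` (the case `β ≤ α`).

* `HasLevelOneInertiaShape.symm_of_isTamelyRamified` — in the TAME case the two exponents of a level-one shape may be swapped: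
  `ρ̄|I_F ∼ (ψ₁^a ∗; 0 ψ₁^b)` and `ρ̄` tame ⟹ `ρ̄|I_F ∼ (ψ₁^b ∗; 0 ψ₁^a)`.  Proof: `ρ̄(I_F)` is diagonalisable
  (`InertiaShape.exists_conj_diagonal_of_isTamelyRamified`, from the cyclicity of tame inertia `absInertia_map_isCyclic_holds`); the two
  diagonal characters `χ₀, χ₁` have, at every `σ ∈ I_F`, the same sum and product as `ψ₁^a(σ), ψ₁^b(σ)` (trace and determinant), so
  `{χ₀(σ), χ₁(σ)} = {ψ₁^a(σ), ψ₁^b(σ)}`; a group is not the union of two proper subgroups, so `(χ₀, χ₁) = (ψ₁^a, ψ₁^b)` or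
  `(ψ₁^b, ψ₁^a)` identically, and conjugating by `J = (0 1; 1 0)` in the first case swaps them (Serre 1987 §2.3: `ρ_I = χ^α ⊕ χ^β`).
* `isSerreWeight_of_hasLevelOneInertiaShape_of_lt` — if `ρ̄|I_F ∼ (ψ₁^β ∗; 0 ψ₁^α)` with `1 ≤ α`, `α + 2 ≤ β`, `β + 2 ≤ q`, then
  `1 + q·α + β` is a Serre weight of `ρ̄`: tame case (2.3.2) with `(a, b) = (α, β)` after the swap; wild case §2.4 (i) with
  `min(α, β) = α`, `max = β`, `β ≠ α + 1`.
* `serreWeightLocal_eq_of_hasLevelOneInertiaShape_of_lt_of_unique`, `serreWeight_eq_of_hasLevelOneInertiaShape_of_lt_of_unique` —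
  GRANTED `IsSerreWeight.unique` (named fact), `ι` injective and `isSerreWeight_serreWeightLocal` (tree theorem, hypothesis here),
  `k(ρ̄) = 1 + q·α + β`.

Consumer: route BSD/TeichmullerTwistDescent, crux `TwistedPeriodLatticeSaturation`, input (W‴) on Kodaira type IV, where the
Teichmüller twist `ω^s ρ̄_E` may have shape `(1 + (p−1)/2, (p−1)/6)`.
References: J.-P. Serre, Duke Math. J. 54 (1987), §2.3 (2.3.1)–(2.3.2), §2.4 (i) [Serre1987]; J.-P. Serre, Invent. Math. 15 (1972),
§1.6 [SerreInventiones1972].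
-/

noncomputable section

open scoped MatrixGroups Valued
open Field ValuativeRel

namespace Literature.NumberTheory.GaloisRepresentations

namespace ModPGaloisRep

open GaloisRepresentations.IsNonarchimedeanLocalField InertiaShape

universe u v

variable {F : Type u} [Field F] [ValuativeRel F] [TopologicalSpace F] [IsNonarchimedeanLocalField F]
variable {k : Type v} [Field k] [TopologicalSpace k]

omit [TopologicalSpace k] in
/-- Trace and determinant of an upper-triangular `2 × 2` matrix `(x c; 0 y)`: a matrix conjugate to it with vanishing
off-diagonal entries has diagonal `{x, y}` (private helper). [folklore] -/
private theorem diag_eq_or_eq_of_conj {P Q g : GL (Fin 2) k} {x y c : k}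
    (hQ : ((Q * g * Q⁻¹ : GL (Fin 2) k) : Matrix (Fin 2) (Fin 2) k) = !![x, c; 0, y])
    (h10 : ((P * g * P⁻¹ : GL (Fin 2) k) : Matrix (Fin 2) (Fin 2) k) 1 0 = 0)
    (h01 : ((P * g * P⁻¹ : GL (Fin 2) k) : Matrix (Fin 2) (Fin 2) k) 0 1 = 0) :
    (((P * g * P⁻¹ : GL (Fin 2) k) : Matrix (Fin 2) (Fin 2) k) 0 0 = x ∧
        ((P * g * P⁻¹ : GL (Fin 2) k) : Matrix (Fin 2) (Fin 2) k) 1 1 = y) ∨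
      (((P * g * P⁻¹ : GL (Fin 2) k) : Matrix (Fin 2) (Fin 2) k) 0 0 = y ∧
        ((P * g * P⁻¹ : GL (Fin 2) k) : Matrix (Fin 2) (Fin 2) k) 1 1 = x) := by
  set D : Matrix (Fin 2) (Fin 2) k := ((P * g * P⁻¹ : GL (Fin 2) k) : Matrix (Fin 2) (Fin 2) k) with hD
  have htrP : D.trace = ((g : GL (Fin 2) k) : Matrix (Fin 2) (Fin 2) k).trace := by
    rw [hD, Units.val_mul, Units.val_mul, Matrix.trace_units_conj]
  have htrQ : (!![x, c; 0, y] : Matrix (Fin 2) (Fin 2) k).trace = ((g : GL (Fin 2) k) : Matrix (Fin 2) (Fin 2) k).trace := by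
    rw [← hQ, Units.val_mul, Units.val_mul, Matrix.trace_units_conj]
  have hdetP : D.det = ((g : GL (Fin 2) k) : Matrix (Fin 2) (Fin 2) k).det := by
    rw [hD, Units.val_mul, Units.val_mul, Matrix.det_units_conj]
  have hdetQ : (!![x, c; 0, y] : Matrix (Fin 2) (Fin 2) k).det = ((g : GL (Fin 2) k) : Matrix (Fin 2) (Fin 2) k).det := by
    rw [← hQ, Units.val_mul, Units.val_mul, Matrix.det_units_conj]
  have h1 : D 0 0 + D 1 1 = x + y := by
    have := htrP.trans htrQ.symm
    rwa [Matrix.trace_fin_two, Matrix.trace_fin_two_of] at this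
  have h2 : D 0 0 * D 1 1 = x * y := by
    have := hdetP.trans hdetQ.symm
    rw [Matrix.det_fin_two, Matrix.det_fin_two_of, h10, h01] at this
    simpa using this
  exact eq_or_eq_of_add_eq_of_mul_eq h1 h2

/-- **Swapping the exponents of a level-one shape in the tame case.**  If `ρ̄` is tamely ramified and
`ρ̄|I_F ∼ (ψ₁^a ∗; 0 ψ₁^b)` then also `ρ̄|I_F ∼ (ψ₁^b ∗; 0 ψ₁^a)` (indeed `ρ̄|I_F ≅ ψ₁^a ⊕ ψ₁^b`): diagonalise `ρ̄(I_F)`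
(`exists_conj_diagonal_of_isTamelyRamified` with `absInertia_map_isCyclic_holds`), compare the diagonal characters with
`ψ₁^a, ψ₁^b` by trace and determinant, use that `I_F` is not a union of two proper subgroups, and conjugate by `J` if needed.
[cite: Serre1987, §2.3 (ρ_I = χ^α ⊕ χ^β)] [cite: SerreInventiones1972, §1.6] -/
theorem HasLevelOneInertiaShape.symm_of_isTamelyRamified [DiscreteTopology k] {ρ : ModPGaloisRep F k 2}
    {ι : absIntegers 𝒪[F] F ⧸ absMaximalIdeal F →+* k} {ϖ : 𝒪[F]} {hϖ : Irreducible ϖ} {a b : ℕ}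
    (ht : ρ.IsTamelyRamified) (h : ρ.HasLevelOneInertiaShape ι ϖ hϖ a b) :
    ρ.HasLevelOneInertiaShape ι ϖ hϖ b a := by
  obtain ⟨P, hP⟩ := exists_conj_diagonal_of_isTamelyRamified (absInertia_map_isCyclic_holds F (GL (Fin 2) k)) ρ ι ht
  obtain ⟨Q, hQ⟩ := h
  set ψ := fundamentalCharacter F 1 ι ϖ hϖ with hψ
  -- the conjugated representation of `I_F` and its diagonal characters
  let f : absInertia F →* GL (Fin 2) k :=
    ((MulAut.conj P).toMonoidHom.comp ρ.toMonoidHom).comp (absInertia F).subtype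
  have hf : ∀ σ : absInertia F, f σ = P * ρ (σ : absoluteGaloisGroup F) * P⁻¹ := fun σ => rfl
  have hf10 : ∀ σ : absInertia F, ((f σ : GL (Fin 2) k) : Matrix (Fin 2) (Fin 2) k) 1 0 = 0 := fun σ => by
    rw [hf]; exact (hP σ).1
  let χ₀ : absInertia F →* kˣ := diagChar f hf10 0
  let χ₁ : absInertia F →* kˣ := diagChar f hf10 1
  -- at every `σ`, `{χ₀ σ, χ₁ σ} = {ψ σ ^ a, ψ σ ^ b}`
  have hστ : ∀ σ : absInertia F, (χ₀ σ = ψ σ ^ a ∧ χ₁ σ = ψ σ ^ b) ∨ (χ₀ σ = ψ σ ^ b ∧ χ₁ σ = ψ σ ^ a) := by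
    intro σ
    obtain ⟨c, hc⟩ := hQ σ
    have h := diag_eq_or_eq_of_conj hc (hP σ).1 (hP σ).2
    rcases h with ⟨h0, h1⟩ | ⟨h0, h1⟩
    · left
      exact ⟨Units.ext (by rw [coe_diagChar_apply, hf]; exact h0), Units.ext (by rw [coe_diagChar_apply, hf]; exact h1)⟩
    · right
      exact ⟨Units.ext (by rw [coe_diagChar_apply, hf]; exact h0), Units.ext (by rw [coe_diagChar_apply, hf]; exact h1)⟩
  -- the two subgroups where the characters agree in one order or the other
  let A : Subgroup (absInertia F) := (χ₀.eqLocus (ψ ^ a)) ⊓ (χ₁.eqLocus (ψ ^ b))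
  let B : Subgroup (absInertia F) := (χ₀.eqLocus (ψ ^ b)) ⊓ (χ₁.eqLocus (ψ ^ a))
  have hAB : ∀ σ, σ ∈ A ∨ σ ∈ B := by
    intro σ
    rcases hστ σ with ⟨h0, h1⟩ | ⟨h0, h1⟩
    · exact Or.inl ⟨by simpa [MonoidHom.eqLocus, MonoidHom.pow_apply] using h0,
        by simpa [MonoidHom.eqLocus, MonoidHom.pow_apply] using h1⟩
    · exact Or.inr ⟨by simpa [MonoidHom.eqLocus, MonoidHom.pow_apply] using h0,
        by simpa [MonoidHom.eqLocus, MonoidHom.pow_apply] using h1⟩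
  -- the diagonal form of `P ρ σ P⁻¹`
  have hdiag : ∀ σ : absInertia F, ((P * ρ (σ : absoluteGaloisGroup F) * P⁻¹ : GL (Fin 2) k) : Matrix (Fin 2) (Fin 2) k) =
      !![(χ₀ σ : k), 0; 0, (χ₁ σ : k)] := by
    intro σ
    rw [← hf, Matrix.eta_fin_two ((f σ : GL (Fin 2) k) : Matrix (Fin 2) (Fin 2) k), hf10 σ]
    have h01 : ((f σ : GL (Fin 2) k) : Matrix (Fin 2) (Fin 2) k) 0 1 = 0 := by rw [hf]; exact (hP σ).2
    rw [h01]
    rfl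
  rcases eq_top_or_eq_top_of_forall_mem_or hAB with hA | hB
  · -- `(χ₀, χ₁) = (ψ^a, ψ^b)`: conjugate by `J`
    refine ⟨swapGL * P, fun σ => ⟨0, ?_⟩⟩
    have hσ : σ ∈ A := hA ▸ Subgroup.mem_top σ
    obtain ⟨h0, h1⟩ := hσ
    have h0' : χ₀ σ = ψ σ ^ a := by simpa [MonoidHom.eqLocus, MonoidHom.pow_apply] using h0
    have h1' : χ₁ σ = ψ σ ^ b := by simpa [MonoidHom.eqLocus, MonoidHom.pow_apply] using h1
    rw [mul_inv_rev, show swapGL * P * ρ (σ : absoluteGaloisGroup F) * (P⁻¹ * swapGL⁻¹) =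
      swapGL * (P * ρ (σ : absoluteGaloisGroup F) * P⁻¹) * swapGL⁻¹ by group, Units.val_mul, Units.val_mul, hdiag σ,
      swapGL_conj_diag, h0', h1']
  · -- `(χ₀, χ₁) = (ψ^b, ψ^a)`: `P` itself works
    refine ⟨P, fun σ => ⟨0, ?_⟩⟩
    have hσ : σ ∈ B := hB ▸ Subgroup.mem_top σ
    obtain ⟨h0, h1⟩ := hσ
    have h0' : χ₀ σ = ψ σ ^ b := by simpa [MonoidHom.eqLocus, MonoidHom.pow_apply] using h0
    have h1' : χ₁ σ = ψ σ ^ a := by simpa [MonoidHom.eqLocus, MonoidHom.pow_apply] using h1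
    rw [hdiag σ, h0', h1']

/-- **`1 + qα + β` is a Serre weight of a representation of level-one shape `(ψ₁^β ∗; 0 ψ₁^α)` with `1 ≤ α`, `α + 2 ≤ β ≤ q − 2`**
— the tame case (2.3.2) with `(a, b) = (α, β)` (after `symm_of_isTamelyRamified`) and the wild case §2.4 (i) (`β ≠ α + 1`,
`min = α`, `max = β`) give the same number. [cite: Serre1987, §2.3 (2.3.2) and §2.4 (i)] -/
theorem isSerreWeight_of_hasLevelOneInertiaShape_of_lt [DiscreteTopology k] (ρ : ModPGaloisRep F k 2)
    (ι : absIntegers 𝒪[F] F ⧸ absMaximalIdeal F →+* k) {ϖ : 𝒪[F]} (hϖ : Irreducible ϖ) {β α : ℕ}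
    (h : ρ.HasLevelOneInertiaShape ι ϖ hϖ β α) (hα : 1 ≤ α) (hαβ : α + 2 ≤ β) (hβ : β + 2 ≤ residueFieldCard F) :
    ρ.IsSerreWeight ι (1 + residueFieldCard F * α + β) := by
  by_cases ht : ρ.IsTamelyRamified
  · refine Or.inr (Or.inl ⟨ht, α, β, by omega, hβ, ⟨ϖ, hϖ, h.symm_of_isTamelyRamified ht⟩, ?_⟩)
    rw [if_neg (by rintro ⟨h0, -⟩; omega)]
  · refine Or.inr (Or.inr ⟨ht, α, β, by omega, by omega, by omega, ⟨ϖ, hϖ, h⟩, ?_⟩)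
    rw [if_neg (by rintro ⟨h0, -⟩; omega), min_eq_left (by omega), max_eq_right (by omega)]

/-- **`k(ρ̄_F) = 1 + qα + β` granted uniqueness of the weight**, for a level-one shape `(ψ₁^β ∗; 0 ψ₁^α)` with `1 ≤ α`,
`α + 2 ≤ β ≤ q − 2`: `serreWeightLocal ρ ι` is a Serre weight (hypothesis `hS`, the tree's `isSerreWeight_serreWeightLocal_holds`) and so
is `1 + qα + β`; `IsSerreWeight.unique` identifies them. [cite: Serre1987, §2.4 (unicité de α, β)] -/
theorem serreWeightLocal_eq_of_hasLevelOneInertiaShape_of_lt_of_unique [DiscreteTopology k] (ρ : ModPGaloisRep F k 2)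
    (ι : absIntegers 𝒪[F] F ⧸ absMaximalIdeal F →+* k) (hU : IsSerreWeight.unique ρ ι) (hι : Function.Injective ι)
    (hS : ρ.isSerreWeight_serreWeightLocal ι) {ϖ : 𝒪[F]} (hϖ : Irreducible ϖ) {β α : ℕ}
    (h : ρ.HasLevelOneInertiaShape ι ϖ hϖ β α) (hα : 1 ≤ α) (hαβ : α + 2 ≤ β) (hβ : β + 2 ≤ residueFieldCard F) :
    ρ.serreWeightLocal ι = 1 + residueFieldCard F * α + β :=
  hU hι hS (isSerreWeight_of_hasLevelOneInertiaShape_of_lt ρ ι hϖ h hα hαβ hβ)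

/-- **Global form**: for a local restriction datum `loc` at `p` of `ρ̄ : Γ_ℚ → GL₂(k)` (residue field `𝔽_p`, uniformiser `p`) with
`loc.rep|I ∼ (ω^β ∗; 0 ω^α)`, `1 ≤ α`, `α + 2 ≤ β ≤ p − 2`, granted uniqueness: `k(ρ̄) = serreWeight p ρ loc ι = 1 + pα + β`.
[cite: Serre1987, §2.3–2.4] -/
theorem serreWeight_eq_of_hasLevelOneInertiaShape_of_lt_of_unique [DiscreteTopology k] {p : ℕ} {ρ : ModPGaloisRep ℚ k 2}
    (loc : LocalRestrictionAt p ρ) (ι : absIntegers 𝒪[loc.F] loc.F ⧸ absMaximalIdeal loc.F →+* k)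
    (hU : IsSerreWeight.unique loc.rep ι) (hι : Function.Injective ι) (hS : loc.rep.isSerreWeight_serreWeightLocal ι) {β α : ℕ}
    (h : loc.rep.HasLevelOneInertiaShape ι ((p : ℕ) : 𝒪[loc.F]) loc.irreducible_natCast β α)
    (hα : 1 ≤ α) (hαβ : α + 2 ≤ β) (hβ : β + 2 ≤ p) :
    serreWeight p ρ loc ι = 1 + p * α + β := by
  have hq := loc.residueFieldCard_eq
  have e := serreWeightLocal_eq_of_hasLevelOneInertiaShape_of_lt_of_unique loc.rep ι hU hι hS loc.irreducible_natCast h hα hαβ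
    (by rw [hq]; exact hβ)
  rw [hq] at e
  exact e

end ModPGaloisRep

end Literature.NumberTheory.GaloisRepresentations
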